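import Literature.Computability.QuantumComplexity.EffectiveCompilerFP
import Literature.Computability.QuantumComplexity.LogLevelSubstitution
import Literature.Computability.QuantumComplexity.PlacementSolovayKitaev
import Literature.Computability.Cryptography.PolyTimeComputableReals
import HarnessLib

/-!
# Effective compilation: the exponential-time compiler, and `PromiseBQPOver G = PromiseBQP` discharged

Last file of the effective gate compiler and the DISCHARGE of the named fact
`PromiseBQPOver_eq_PromiseBQP` (`JonesInBQPProofs.lean`; gate-set independence of `PromiseBQP`:
for every finite, unitary, placement-universal, inverse-closed gate set `G` with polynomial-time
computable entries, `PromiseBQPOver G = PromiseBQP`), with the corollary `BQPOver_eq_BQP_holds`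
(quantum-advantage.S26, via `BQPOver_eq_BQP_of_promise`).

* **Names** (`exists_gaussName`): a polynomial-time computable complex number (Bernstein–Vazirani
  1997, §6; Ko 1991, Def. 2.1) has a dyadic Gaussian name `g p / 2ᵖ`, `2/2ᵖ`-accurate, computed on
  codes from the unary precision (the polynomial-time names of the real and imaginary parts, through
  `IsPolyTimeComputableReal.nameFn_mem_FP` and the code conversions of `CodeFPArith.lean`).
* **Valid data** (`exists_valid_data`): for a unitary target with polynomial-time computable entries
  over a finite unitary inverse-closed gate set whose placements on `M ≥ 1` wires generate `U(2ᴹ)`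
  densely modulo phase — generators = all placements, names of the placed entries (an entry of the
  gate or `0`), and the Solovay–Kitaev theorem of the tree (`PlacementSolovayKitaev.exists_placementWord`,
  itself from `solovay_kitaev_holds`) converted to index words with the length bound
  `C log(1/ε)^c ≤ 2^{⌈C⌉ + ⌈c⌉(3+M+k)}` at `ε = 2^{-(3+M+k)}` (`sk_length_le`) and the operator-norm
  accuracy converted to the phase-invariant Frobenius distance.
* **The compiler** (`exists_sound_expTime_compiler`): for source gate `g` of arity `a`, target
  `gate ⊗ 1` on `a + n₁` wires (`n₁ = max n₀ 1`, scratch block `n₁`), word of level `k` = the compiled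
  circuit of `EffectiveCompiler.lean`; `Sound` by `sound_level`, `ExpTime` by `codeFP_rawGates_wordCirc`.
* **`PromiseBQPOver_eq_PromiseBQP_holds`** := `PromiseBQPOver_eq_PromiseBQP_of_expTime` (log-level
  substitution, `LogLevelSubstitution.lean`) applied to the compiler; `BQPOver_eq_BQP_holds`.

What the printed sources leave implicit and this development supplies: Dawson–Nielsen 2006 (§1, p. 6)
"entirely ignore[s] the precision with which arithmetical operations are carried out"; here the
compiler is an exact integer program whose polynomial running time (in `1/ε`) and correctness
(rounding, clamping, packing, closure) are proved in the tree's `TM2`-based model of polynomial time.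
Everything is proved; no named facts are introduced.

## References

* C. M. Dawson, M. A. Nielsen, *The Solovay–Kitaev algorithm*, Quantum Inf. Comput. 6 (2006)
  81–95, arXiv:quant-ph/0505030, Thm. 1, §5 [DawsonNielsen2006].
* E. Bernstein, U. Vazirani, *Quantum complexity theory*, SIAM J. Comput. 26 (1997), Def. 3.2, §6,
  §8 [BernsteinVazirani1997].
* K.-I. Ko, *Complexity Theory of Real Functions*, Birkhäuser 1991, Def. 2.1 [Ko1991].
* M. A. Nielsen, I. L. Chuang, *Quantum Computation and Quantum Information*, CUP 2010, §4.5.3–4.5.5,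
  App. 3 [NielsenChuang2010].
* J. Watrous, *Quantum computational complexity*, arXiv:0804.3401 (2009), Def. 2, Thm. 1, Prop. 3
  [Watrous2009].
* S. Arora, B. Barak, *Computational Complexity: A Modern Approach*, CUP 2009, §10.3.8 [AroraBarak2009].
-/

noncomputable section

namespace Literature.Computability.QuantumComplexity

open _root_.Computability Complexity Complexity.CodeFP Cryptography GaussianInt Matrix PhaseFrobenius NetCompiler

/-! ### Dyadic Gaussian names of polynomial-time computable complex numbers -/

/-- **A polynomial-time name of a real is computed on codes** (unary precision in, integer code out).
[cite: Ko1991, Def. 2.1] [cite: AroraBarak2009, §1.3] -/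
theorem codeFP_of_polyTimeName {f : ℕ → ℤ} (hf : PolyTimeComputable unaryEncodeNat encodingIntBool.encode f) :
    CodeFP unE intE f := by
  have h1 : CodeFP unE smE f :=
    ⟨fun w => encodingIntBool.encode (f w.length), IsPolyTimeComputableReal.nameFn_mem_FP hf, fun n => by
      simp [unE, smE]⟩
  exact (intOfSM.comp h1).congr fun _ => rfl

/-- **Every polynomial-time computable complex number has a dyadic Gaussian name computed on
codes**: `g p / 2ᵖ` is within `2/2ᵖ` of `z`. [cite: BernsteinVazirani1997, §6] [cite: Ko1991, Def. 2.1] -/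
theorem exists_gaussName {z : ℂ} (hz : z ∈ polyTimeComputableComplex) :
    ∃ g : ℕ → GaussianInt, CodeFP unE gE g ∧ ∀ p : ℕ, ‖((2 : ℂ) ^ p)⁻¹ * toComplex (g p) - z‖ ≤ 2 / 2 ^ p := by
  obtain ⟨⟨fre, hfre, hre⟩, ⟨fim, hfim, him⟩⟩ := hz
  refine ⟨fun p => ⟨fre p, fim p⟩, codeFP_gmk' (codeFP_of_polyTimeName hfre) (codeFP_of_polyTimeName hfim), fun p => ?_⟩
  have hc : ((2 : ℂ) ^ p)⁻¹ = ((((2 : ℝ) ^ p)⁻¹ : ℝ) : ℂ) := by push_cast; rfl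
  set w : ℂ := ((2 : ℂ) ^ p)⁻¹ * toComplex ⟨fre p, fim p⟩ - z with hw
  have hwre : w.re = (fre p : ℝ) / 2 ^ p - z.re := by
    rw [hw, hc, Complex.sub_re, Complex.re_ofReal_mul, toComplex_def₂]; simp [div_eq_inv_mul]
  have hwim : w.im = (fim p : ℝ) / 2 ^ p - z.im := by
    rw [hw, hc, Complex.sub_im, Complex.im_ofReal_mul, toComplex_def₂]; simp [div_eq_inv_mul]
  have h1 : |w.re| ≤ (1 / 2 : ℝ) ^ p := by rw [hwre, abs_sub_comm]; exact hre p
  have h2 : |w.im| ≤ (1 / 2 : ℝ) ^ p := by rw [hwim, abs_sub_comm]; exact him p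
  calc ‖w‖ ≤ |w.re| + |w.im| := Complex.norm_le_abs_re_add_abs_im w
    _ ≤ (1 / 2 : ℝ) ^ p + (1 / 2 : ℝ) ^ p := add_le_add h1 h2
    _ = 2 / 2 ^ p := by rw [one_div, inv_pow]; ring

/-! ### The data of the compiler for one source gate -/

section Build

variable {G : QGateSet} [Finite G.Op] [Encodable G.Op] {M : ℕ}

/-- The Solovay–Kitaev length bound in power-of-two form: `C · log(1/ε)^c ≤ 2^{⌈C⌉ + ⌈c⌉ (3 + M + k)}`
for `ε = 2^{-(3 + M + k)}`. [folklore] -/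
theorem sk_length_le {C c : ℝ} (hc : 0 < c) (M k : ℕ) :
    C * Real.log (1 / (1 / ((2 : ℝ) ^ (3 + M + k)))) ^ c ≤ (2 : ℝ) ^ (⌈C⌉₊ + ⌈c⌉₊ * (3 + M + k)) := by
  have hx : Real.log (1 / (1 / ((2 : ℝ) ^ (3 + M + k)))) ≤ (3 + M + k : ℕ) := by
    rw [one_div_one_div, Real.log_pow]
    have h2 : Real.log 2 ≤ 1 := by have := Real.log_le_sub_one_of_pos (x := 2) two_pos; linarith
    calc ((3 + M + k : ℕ) : ℝ) * Real.log 2 ≤ (3 + M + k : ℕ) * 1 := by gcongr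
      _ = _ := mul_one _
  have hx0 : 0 ≤ Real.log (1 / (1 / ((2 : ℝ) ^ (3 + M + k)))) := by
    rw [one_div_one_div, Real.log_pow]; positivity
  have hbase : (1 : ℝ) ≤ (3 + M + k : ℕ) := by exact_mod_cast (by omega : 1 ≤ 3 + M + k)
  have hpow : Real.log (1 / (1 / ((2 : ℝ) ^ (3 + M + k)))) ^ c ≤ (2 : ℝ) ^ (⌈c⌉₊ * (3 + M + k)) :=
    calc Real.log (1 / (1 / ((2 : ℝ) ^ (3 + M + k)))) ^ c ≤ ((3 + M + k : ℕ) : ℝ) ^ c := Real.rpow_le_rpow hx0 hx hc.le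
      _ ≤ ((3 + M + k : ℕ) : ℝ) ^ (⌈c⌉₊ : ℝ) := Real.rpow_le_rpow_of_exponent_le hbase (Nat.le_ceil c)
      _ = ((3 + M + k : ℕ) : ℝ) ^ ⌈c⌉₊ := Real.rpow_natCast _ _
      _ ≤ ((2 ^ (3 + M + k) : ℕ) : ℝ) ^ ⌈c⌉₊ := by
          gcongr; exact_mod_cast (Nat.lt_two_pow_self).le
      _ = (2 : ℝ) ^ (⌈c⌉₊ * (3 + M + k)) := by push_cast; rw [← pow_mul, mul_comm]
  have hCle : C ≤ (2 : ℝ) ^ ⌈C⌉₊ :=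
    (Nat.le_ceil C).trans (by exact_mod_cast (Nat.lt_two_pow_self (n := ⌈C⌉₊)).le)
  calc C * Real.log (1 / (1 / ((2 : ℝ) ^ (3 + M + k)))) ^ c ≤ (2 : ℝ) ^ ⌈C⌉₊ * (2 : ℝ) ^ (⌈c⌉₊ * (3 + M + k)) :=
        mul_le_mul hCle hpow (Real.rpow_nonneg hx0 c) (by positivity)
    _ = (2 : ℝ) ^ (⌈C⌉₊ + ⌈c⌉₊ * (3 + M + k)) := by rw [← pow_add]

omit [Encodable G.Op] in
/-- **Existence of valid, effectively named data** for a unitary target with polynomial-time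
computable entries, over a finite unitary inverse-closed gate set with polynomial-time computable
entries whose placements on `M ≥ 1` wires generate `U(2ᴹ)` densely modulo phase (so that the
Solovay–Kitaev theorem of `PlacementSolovayKitaev.lean` applies). [cite: DawsonNielsen2006, Thm. 1 and §5] -/
theorem exists_valid_data (hU : G.IsUnitary) (hinv : G.IsInverseClosed)
    (hcomp : ∀ (h : G.Op) (u v : QReg (G.arity h)), G.mat h u v ∈ polyTimeComputableComplex)
    (hM : 1 ≤ M) (hdense : GeneratesDenselyModPhase M (placements G M))
    {U : Matrix (QReg M) (QReg M) ℂ} (hUu : U ∈ Matrix.unitaryGroup (QReg M) ℂ)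
    (hUc : ∀ x y, U x y ∈ polyTimeComputableComplex) :
    ∃ D : Data G M, D.Valid U ∧ (∀ (i : ℕ) (x y : QReg M), CodeFP unE gE fun p => D.gname i x y p) ∧
      ∀ x y : QReg M, CodeFP unE gE fun p => D.tname x y p := by
  classical
  haveI : Fintype G.Op := Fintype.ofFinite G.Op
  -- the generators
  set pl : List (Σ h : G.Op, Fin (G.arity h) ↪ Fin M) := (Finset.univ : Finset (Σ h : G.Op, Fin (G.arity h) ↪ Fin M)).toList
    with hpl
  obtain ⟨P₀, h₀, e₀, rfl⟩ := nonempty_placements_of_generatesDenselyModPhase hdense hM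
  -- the names
  choose nm hnm_fp hnm using fun (h : G.Op) (u v : QReg (G.arity h)) => exists_gaussName (hcomp h u v)
  choose tn htn_fp htn using fun x y : QReg M => exists_gaussName (hUc x y)
  -- the Solovay–Kitaev constants
  obtain ⟨C, c, hC, hc, hsk⟩ := exists_placementWord hU hinv hdense hM
  let gname : ℕ → QReg M → QReg M → ℕ → GaussianInt := fun i x y p =>
    let q := pl.getD i ⟨h₀, e₀⟩
    if ∀ w, w ∉ Set.range q.2 → x w = y w then nm q.1 (x ∘ q.2) (y ∘ q.2) p else 0
  let D : Data G M := ⟨pl, ⟨h₀, e₀⟩, gname, tn, ⌈C⌉₊, ⌈c⌉₊⟩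
  have hgenU : ∀ i, D.genU i = placeGate (pl.getD i ⟨h₀, e₀⟩).2 (G.mat (pl.getD i ⟨h₀, e₀⟩).1) := fun i => rfl
  refine ⟨D, ?_, fun i x y => ?_, fun x y => htn_fp x y⟩
  · refine ⟨hM, hU, fun i _ x y p => ?_, fun x y p => htn x y p, hUu, fun k => ?_⟩
    · -- accuracy of the generator names
      show ‖((2 : ℂ) ^ p)⁻¹ * toComplex (gname i x y p) - D.genU i x y‖ ≤ 2 / 2 ^ p
      rw [hgenU, placeGate_apply]
      simp only [gname]
      split_ifs with hxy
      · exact hnm _ _ _ p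
      · have h0 : (0 : ℝ) ≤ 2 / 2 ^ p := by positivity
        simpa using h0
    · -- the Solovay–Kitaev word, as an index word
      have hε : (0 : ℝ) < 1 / (2 : ℝ) ^ (3 + M + k) := by positivity
      have hε' : 1 / (2 : ℝ) ^ (3 + M + k) ≤ 1 / 2 := by
        rw [one_div_le_one_div (by positivity) two_pos]
        calc (2 : ℝ) = 2 ^ 1 := (pow_one 2).symm
          _ ≤ 2 ^ (3 + M + k) := pow_le_pow_right₀ one_le_two (by omega)
      obtain ⟨l, a, hl, hlen, ha, hdist⟩ := hsk _ hε hε' U hUu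
      -- indices of the placements of `l`
      have hidx : ∀ P ∈ l, ∃ i < pl.length, D.genU i = P := fun P hP => by
        obtain ⟨h, e, rfl⟩ := hl P hP
        have hmem : (⟨h, e⟩ : Σ h : G.Op, Fin (G.arity h) ↪ Fin M) ∈ pl := by rw [hpl, Finset.mem_toList]; exact Finset.mem_univ _
        obtain ⟨i, hi, hget⟩ := List.getElem_of_mem hmem
        refine ⟨i, hi, ?_⟩
        rw [hgenU, List.getD_eq_getElem _ _ hi, hget]
      choose! idx hidx_lt hidx_eq using hidx
      refine ⟨(l.map idx).reverse, fun i hi => ?_, ?_, ?_⟩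
      · rw [List.mem_reverse, List.mem_map] at hi
        obtain ⟨P, hP, rfl⟩ := hi
        exact hidx_lt P hP
      · rw [List.length_reverse, List.length_map]
        have h := hlen.trans (sk_length_le hc M k)
        change (l.length : ℝ) ≤ (2 : ℝ) ^ D.qExp k at h
        exact_mod_cast h
      · have hw : wmat D.genU (l.map idx).reverse = l.prod := by
          rw [wmat, List.reverse_reverse, List.map_map]
          have hl' : l.map (D.genU ∘ idx) = l := by
            conv_rhs => rw [← List.map_id l]
            exact List.map_congr_left fun P hP => hidx_eq P hP
          rw [hl']
        rw [hw]
        refine (phaseDist_le_of_opNorm_sub_smul_le ha hε.le hdist).trans (le_of_eq ?_)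
        rw [NetCompiler.card_QReg_eq]; push_cast
        rw [pow_add, pow_add]; field_simp; ring
  · -- the generator names are computed on codes
    change CodeFP unE gE fun p => gname i x y p
    simp only [gname]
    split_ifs with hxy
    · exact hnm_fp _ _ _
    · exact CodeFP.const unE (0 : GaussianInt)

end Build

/-! ### The compiler -/

/-- Entries of a placed gate with polynomial-time computable entries are polynomial-time
computable (an entry of the gate, or `0`). [cite: BernsteinVazirani1997, §6] -/
theorem placeGate_apply_mem_polyTimeComputableComplex {k n : ℕ} (e : Fin k ↪ Fin n)
    {V : Matrix (QReg k) (QReg k) ℂ} (hV : ∀ u v, V u v ∈ polyTimeComputableComplex) (x y : QReg n) :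
    placeGate e V x y ∈ polyTimeComputableComplex := by
  rw [placeGate_apply]
  split_ifs
  · exact hV _ _
  · exact isPolyTimeComputableComplex_zero

/-- **The effective Solovay–Kitaev compiler.** Into any finite, unitary, inverse-closed,
placement-universal gate set with polynomial-time computable entries, every finite unitary gate set
with polynomial-time computable entries is compiled by a SOUND (`GateCompiler.Sound`: the word of
level `k` implements its gate up to a global phase within `2⁻ᵏ`) and EXPONENTIAL-TIME
(`GateCompiler.ExpTime`: the word of level `⌊log₂ N⌋` is computed on codes from `1ᴺ`) gate compiler:
for a source gate of arity `a`, the target `(gate ⊗ 1)` on `a + n₀` wires (`n₀ ≥ 1` the universality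
threshold of the target set) is compiled by the net compiler of `NetCompilerSpec.lean` run on the
Gaussian-integer names of the placements (`EffectiveCompiler.sound_level`,
`EffectiveCompilerFP.codeFP_rawGates_wordCirc`), the Solovay–Kitaev theorem
(`PlacementSolovayKitaev.exists_placementWord`) supplying the short word that makes the lookup
succeed. [cite: DawsonNielsen2006, Thm. 1 and §5] [cite: BernsteinVazirani1997, §6] [cite: NielsenChuang2010, §4.5.3] -/
theorem exists_sound_expTime_compiler (G₁ G₂ : QGateSet) [Finite G₁.Op] [Encodable G₁.Op] [Finite G₂.Op]
    [Encodable G₂.Op] (hU₁ : G₁.IsUnitary)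
    (hC₁ : ∀ (g : G₁.Op) (i j : QReg (G₁.arity g)), G₁.mat g i j ∈ polyTimeComputableComplex)
    (hU₂ : G₂.IsUnitary) (huniv : G₂.IsUniversal) (hinv : G₂.IsInverseClosed)
    (hC₂ : ∀ (g : G₂.Op) (i j : QReg (G₂.arity g)), G₂.mat g i j ∈ polyTimeComputableComplex) :
    ∃ W : GateCompiler G₁ G₂, W.Sound ∧ W.ExpTime := by
  obtain ⟨n₀, hn₀⟩ := huniv
  set n₁ := max n₀ 1 with hn₁def
  have hn₁ : ∀ n ≥ n₁, GeneratesDenselyModPhase n (placements G₂ n) := fun n hn =>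
    hn₀ n (le_trans (le_max_left _ _) hn)
  have hdata : ∀ g : G₁.Op, ∃ D : Data G₂ (G₁.arity g + n₁),
      D.Valid (placeGate (Fin.castAddEmb n₁) (G₁.mat g)) ∧
      (∀ (i : ℕ) (x y : QReg (G₁.arity g + n₁)), CodeFP unE gE fun p => D.gname i x y p) ∧
      ∀ x y : QReg (G₁.arity g + n₁), CodeFP unE gE fun p => D.tname x y p := fun g =>
    exists_valid_data hU₂ hinv hC₂ (le_trans (le_max_right n₀ 1) (Nat.le_add_left _ _))
      (hn₁ _ (Nat.le_add_left _ _)) (placeGate_mem_unitaryGroup_holds _ (hU₁ g))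
      (placeGate_apply_mem_polyTimeComputableComplex _ (hC₁ g))
  choose D hvalid hg ht using hdata
  refine ⟨⟨n₁, fun _ => n₁, fun _ => le_rfl, fun k g => (D g).wordCirc k⟩,
    ⟨fun k g => (D g).isOracleFree_wordCirc k, fun k g => NetCompiler.Data.sound_level (hvalid g) k⟩,
    ⟨fun g => (D g).codeFP_rawGates_wordCirc (hg g) (ht g)⟩⟩

/-! ### The named fact -/

/-- **Gate-set independence of `PromiseBQP`** — the named fact `PromiseBQPOver_eq_PromiseBQP` of
`JonesInBQPProofs.lean`, DISCHARGED: for every finite, unitary, placement-universal, inverse-closed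
gate set `G` with polynomial-time computable entries, `PromiseBQPOver G = PromiseBQP`. Assembled from
the reduction `PromiseBQPOver_eq_PromiseBQP_of_expTime` (`LogLevelSubstitution.lean`: substitution at
logarithmic accuracy level preserves uniformity and moves statistics by `< 2⁻ᵗ`; promise error
reduction `PromiseBQPWith_eq_PromiseBQP`; Clifford+`T` universality, unitarity, inverse-closedness and
polynomial-time entries from the tree) and the effective compiler `exists_sound_expTime_compiler`.
[cite: DawsonNielsen2006, Thm. 1] [cite: BernsteinVazirani1997, §6 and §8] [cite: NielsenChuang2010, §4.5.3] [cite: Watrous2009, Prop. 3] -/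
theorem PromiseBQPOver_eq_PromiseBQP_holds : PromiseBQPOver_eq_PromiseBQP :=
  PromiseBQPOver_eq_PromiseBQP_of_expTime fun G₁ G₂ _ _ _ _ hU₁ hC₁ hU₂ huniv hinv hC₂ =>
    exists_sound_expTime_compiler G₁ G₂ hU₁ hC₁ hU₂ huniv hinv hC₂

/-- **Gate-set independence of `BQP`** (quantum-advantage.S26, the named fact `BQPOver_eq_BQP` of
`BQP.lean`), as a corollary (`BQPOver_eq_BQP_of_promise`, `BQPOverPromise.lean`).
[cite: DawsonNielsen2006, Thm. 1] [cite: NielsenChuang2010, §4.5.3] -/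
theorem BQPOver_eq_BQP_holds : BQPOver_eq_BQP := BQPOver_eq_BQP_of_promise PromiseBQPOver_eq_PromiseBQP_holds

end Literature.Computability.QuantumComplexity

end
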